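import Literature.MathematicalPhysics.QuantumFieldTheory.Balaban1983to89.Beta.RemainderDecay190SectGTorus
import Literature.MathematicalPhysics.QuantumFieldTheory.Balaban1983to89.B11AxialTransport190
import Literature.MathematicalPhysics.QuantumFieldTheory.Balaban1983to89.B6RandomWalkHom

/-!
# `Beta.RemainderDecay190SectGBlocks` — (190) of [15] Sect. G IN PRINT'S BLOCK CURRENCY: the (D4) socket's NODE D on the
# torus of BLOCKS, for configuration lattices fibred over it by arbitrary block maps, with every letter an
# ℓ^∞ → ℓ^∞ BLOCK-OPERATOR-NORM bound (= a block row-mass bound); the dictionary with `B11SectG.HasMaj` ∕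
# `B6RandomWalkHom.HasMajorantHom` for general block maps between two lattices

statement-level skeleton of published theorems with citation tags; proofs where landed; nothing here is a claim about
the Yang–Mills mass gap.  Cell `pub-balaban`, β-function sub-cell, BINDER row D4 (owner lineage `b2b-balaban-beta-an4`,
generation 92).  HONEST FRAMING (binding): bookkeeping for rung (B)+1; the (D4) instance is NOT constructed here (instance
0∕1, critical-path width 0 = NODE O); NOT B12 Thm 2, NOT `BetaPertH`, NOT the continuum limit, NOT Clay.  HONEST
DEPENDENCY: continuum YM on T⁴ ⇐ BetaPertH ∧ nine spine estimates (0/9 proved); BetaPertH ⇐ (D1) ∧ (D4) ∧ CAP+tail.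

CITATIONS.  [15] = T. Bałaban, CMP **102** (1985) 277–309, Sect. G (182)–(190) pp. 307–308; (190) verbatim: *"… yield
|(δ∕δB_ν(y′))𝓗_μ(B,x)|, … ≤ O(1)[(L^jη)^{−1}, …]·(L^{j′}η)^{−d} exp(−⅛δ₀d(y,y′)) (190) for x ∈ Δ(y), or supp ζ ⊂ Δ̃(y),
y ∈ Λ_j, y′ ∈ Λ_{j′}"* — a bound on δ𝓗 OVER THE BLOCK Δ(y) for sources supported in the block of y′: an ℓ^∞ → ℓ^∞
bound BLOCK TO BLOCK.  [3] = T. Bałaban, CMP **96** (1984) 223–250, (2.51)–(2.52) p. 232 (*"|(Tλ)(x)| ≤ K(y, y′)|λ|,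
x ∈ B^j(y), supp λ ⊂ B^{j′}(y′)"*), Lemma 2.1 (2.61) p. 234.  [9] = T. Bałaban, CMP **99** (1985) 389–434, Thm 3.10
(3.108) p. 416 (walk terms bounded as OPERATORS between blocks; products summed over the intermediate BLOCK).

WHAT THIS FILE PROVES (proof lane; 0 `def`).
§1 THE DICTIONARY, for a general `B6.Geometry` 𝔅 and two finite lattices `X₁`, `X₂` fibred over 𝔅 by block maps
`blk₁`, `blk₂`, a real linear map `T : (X₁ → ℝ) →ₗ[ℝ] (X₂ → ℝ)` and a kernel `K` on 𝔅 × 𝔅 [folklore]: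
`apply_eq_sum_single` ((Tμ)(x) = Σ_{x₁} T(δ_{x₁})(x)·μ(x₁)); **`hasMajorantHom_iff_blockRowSum_le`**: pv08's two-lattice
majorant `B6RandomWalkHom.HasMajorantHom blk₁ blk₂ T K` IS the BLOCK ROW-MASS bound
`∀ x y′, Σ_{x₁ ∈ blk₁⁻¹ y′} |T(δ_{x₁})(x)| ≤ K(blk₂ x, y′)` — the ℓ^∞ → ℓ^∞ operator norm of the (blk₂ x, y′) block
(the shape of the cell's `Gaps.D4WalkBlock.blockNorm ≤ K` for real matrices); **`hasMaj_ofBlocks_of_blockRowSum_le`**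
(`K ≥ 0`: the bound gives `B11SectG.HasMaj (ofBlocks 𝔅 blk₁) (ofBlocks 𝔅 blk₂) T K` between the sharp block sup-sizes —
two-lattice form of `B11SectG.hasMaj_of_hasMajorant`), **`blockRowSum_le_of_hasMaj_ofBlocks`** (converse),
`hasMaj_ofBlocks_iff_blockRowSum_le`; matrix forms `hasMaj_ofBlocks_toLin'_of_blockRowSum_le`,
`blockRowSum_le_of_hasMaj_ofBlocks_toLin'` (`Σ_{x₁ ∈ blk₁⁻¹ y′} |A x x₁|`).
§2 **`block190_of_sectG_torusGeom`**: NODE D's field `Data190.h190` ((190)) ON THE TORUS OF BLOCKS `UT (Nf n)` — the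
B-lattice `XB n`, the A-lattice `XA n` and the |·|₍₋₃₎-lattice `X3 n` of the n-th step fibred over it by block maps, the
seven Sect. G operators G̃, W, Δ⁽²⁾H₀, H₀, H, 𝔄₀, 𝔇 and δ𝓗 as real linear maps between them with BLOCK letters
(torus-free constants, rate δ₀; (189) author-omitted, cell GAPS G-B11-G2), the carriers (184)∕(182), the Neumann ratio
`qG 1 1 B_G θ_W c < 1` of (187) and a constant `Cst` above the written-out O(1) — conclusion (190) IN PRINT'S SHAPE:
`Σ_{x′ ∈ blkB⁻¹ y′} |δ𝓗_n(δ_{x′})(x)| ≤ Cst·e^{−⅛δ15·d₁(blkA x, y′)}`, by `RemainderDecay190SectGTorus.h190_of_sectG_torusGeom`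
in the sharp block sizes (κ = 1) read back through §1; `block190_of_sectG_torusGeom_toLin'` (matrix letters).  The
generation-91 ENTRYWISE currency `entry190_of_sectG_torusGeom` is the case `blk = id` (one-site blocks).  Nothing of
Bałaban's is constructed; the operators and block maps are parameters (NODE O).
-/

namespace Literature.MathematicalPhysics.QuantumFieldTheory.Balaban1983to89.Beta.RemainderDecay190SectGBlocks

open Literature.MathematicalPhysics.QuantumFieldTheory.Balaban1983to89 B11SectG B6RandomWalk
open Literature.MathematicalPhysics.QuantumFieldTheory.Balaban1983to89.B6RandomWalkHom (HasMajorantHom)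
open Literature.MathematicalPhysics.QuantumFieldTheory.Balaban1983to89.B11AxialTransport190
  (abs_le_loc_ofBlocks loc_ofBlocks_le)
open Literature.MathematicalPhysics.QuantumFieldTheory.Balaban1983to89.B9Thm34Ext (toB6)
open Literature.MathematicalPhysics.QuantumFieldTheory.Balaban1983to89.B9Thm37GlueTorus (torusGeom tdist1)
open Literature.MathematicalPhysics.QuantumFieldTheory.Balaban1983to89.B5TorusCover (UT)
open Literature.MathematicalPhysics.QuantumFieldTheory.Balaban1983to89.Beta.RemainderDecay190SectGTorus
  (h190_of_sectG_torusGeom)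

/-! ## 1. The dictionary: block majorants between the sharp block sizes ARE block row-mass bounds -/
section Dictionary

variable {g : B6.Geometry} [DecidableEq g.Site] {X₁ X₂ : Type} [Fintype X₁] [DecidableEq X₁]

/-- (Tμ)(x) = Σ_{x₁} T(δ_{x₁})(x)·μ(x₁): a real linear map between two function lattices is its matrix — the kernel
representation of [9] (3.48) for the counting pairing. [cite: Balaban1985BackgroundPropagators, (3.48) p.398] -/
theorem apply_eq_sum_single (T : (X₁ → ℝ) →ₗ[ℝ] (X₂ → ℝ)) (μ : X₁ → ℝ) (x : X₂) :
    T μ x = ∑ x₁ : X₁, T (Pi.single x₁ 1) x * μ x₁ := by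
  conv_lhs => rw [B9Thm34Inv.pi_eq_sum_single μ, map_sum, Finset.sum_apply]
  refine Finset.sum_congr rfl fun x₁ _ => ?_
  rw [map_smul, Pi.smul_apply, smul_eq_mul, mul_comm]

/-- For `μ` vanishing off the block of `y′` the matrix expansion of `(Tμ)(x)` runs over that block. [folklore] -/
private theorem apply_eq_sum_filter_of_off (blk₁ : X₁ → g.Site) (T : (X₁ → ℝ) →ₗ[ℝ] (X₂ → ℝ)) {μ : X₁ → ℝ}
    {y' : g.Site} (hoff : ∀ x₁, blk₁ x₁ ≠ y' → μ x₁ = 0) (x : X₂) :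
    T μ x = ∑ x₁ ∈ Finset.univ.filter (fun x₁ => blk₁ x₁ = y'), T (Pi.single x₁ 1) x * μ x₁ := by
  rw [apply_eq_sum_single, Finset.sum_filter]
  refine Finset.sum_congr rfl fun x₁ _ => ?_
  by_cases h : blk₁ x₁ = y'; · rw [if_pos h]
  rw [if_neg h, hoff x₁ h, mul_zero]

/-- |(Tμ)(x)| ≤ (Σ_{x₁ ∈ blk₁⁻¹ y′} |T(δ_{x₁})(x)|)·B for `supp μ ⊂ Δ(y′)`, `|μ| ≤ B` there. [folklore]
[cite: Balaban1984PropagatorsII, (2.51) p.232] -/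
theorem abs_apply_le_blockRowSum_mul (blk₁ : X₁ → g.Site) (T : (X₁ → ℝ) →ₗ[ℝ] (X₂ → ℝ)) {μ : X₁ → ℝ}
    {y' : g.Site} {B : ℝ} (hoff : ∀ x₁, blk₁ x₁ ≠ y' → μ x₁ = 0) (hbd : ∀ x₁, blk₁ x₁ = y' → |μ x₁| ≤ B)
    (x : X₂) :
    |T μ x| ≤ (∑ x₁ ∈ Finset.univ.filter (fun x₁ => blk₁ x₁ = y'), |T (Pi.single x₁ 1) x|) * B := by
  rw [apply_eq_sum_filter_of_off blk₁ T hoff x, Finset.sum_mul]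
  refine (Finset.abs_sum_le_sum_abs _ _).trans (Finset.sum_le_sum fun x₁ hx₁ => ?_)
  rw [abs_mul]
  exact mul_le_mul_of_nonneg_left (hbd x₁ (Finset.mem_filter.1 hx₁).2) (abs_nonneg _)

/-- The SIGN-PATTERN test source of the row `x` on the block of `y′` turns `(Tμ)(x)` into the row mass. [folklore] -/
private theorem apply_signSource_eq_blockRowSum (blk₁ : X₁ → g.Site) (T : (X₁ → ℝ) →ₗ[ℝ] (X₂ → ℝ)) (y' : g.Site)
    (x : X₂) :
    T (fun x₁ => if blk₁ x₁ = y' then (if 0 ≤ T (Pi.single x₁ 1) x then 1 else -1) else 0) x =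
      ∑ x₁ ∈ Finset.univ.filter (fun x₁ => blk₁ x₁ = y'), |T (Pi.single x₁ 1) x| := by
  rw [apply_eq_sum_filter_of_off blk₁ T (y' := y') (fun x₁ hx₁ => by simp only [hx₁, if_false]) x]
  refine Finset.sum_congr rfl fun x₁ hx₁ => ?_
  rw [if_pos (Finset.mem_filter.1 hx₁).2]
  by_cases h0 : 0 ≤ T (Pi.single x₁ 1) x; · rw [if_pos h0, mul_one, abs_of_nonneg h0]
  rw [if_neg h0, mul_neg, mul_one, abs_of_neg (lt_of_not_ge h0)]

omit [Fintype X₁] in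
/-- The sign-pattern test source is supported in the block of `y′` and bounded by 1. [folklore] -/
private theorem blockSupp_signSource (blk₁ : X₁ → g.Site) (T : (X₁ → ℝ) →ₗ[ℝ] (X₂ → ℝ)) (y' : g.Site) (x : X₂) :
    BlockSupp blk₁ (fun x₁ => if blk₁ x₁ = y' then (if 0 ≤ T (Pi.single x₁ 1) x then 1 else -1) else 0) y' 1 := by
  refine ⟨zero_le_one, fun x₁ hx₁ => ?_, fun x₁ hx₁ => by simp only [hx₁, if_false]⟩
  simp only [hx₁, if_true]
  split_ifs <;> simp

/-- **`HasMajorantHom` ⟹ block row-mass bound**: test the majorant on the sign pattern of the row.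
[cite: Balaban1984PropagatorsII, (2.51) p.232] -/
theorem blockRowSum_le_of_hasMajorantHom (blk₁ : X₁ → g.Site) (blk₂ : X₂ → g.Site)
    {T : (X₁ → ℝ) →ₗ[ℝ] (X₂ → ℝ)} {K : g.Site → g.Site → ℝ} (h : HasMajorantHom blk₁ blk₂ T K) :
    ∀ (x : X₂) (y' : g.Site),
      ∑ x₁ ∈ Finset.univ.filter (fun x₁ => blk₁ x₁ = y'), |T (Pi.single x₁ 1) x| ≤ K (blk₂ x) y' := by
  intro x y'
  have h1 := h y' _ 1 (blockSupp_signSource blk₁ T y' x) x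
  rw [apply_signSource_eq_blockRowSum blk₁ T y' x, mul_one] at h1
  exact le_trans (le_abs_self _) h1

/-- **Block row-mass bound ⟹ `HasMajorantHom`** (no sign condition on K needed).
[cite: Balaban1984PropagatorsII, (2.51) p.232] -/
theorem hasMajorantHom_of_blockRowSum_le (blk₁ : X₁ → g.Site) (blk₂ : X₂ → g.Site)
    {T : (X₁ → ℝ) →ₗ[ℝ] (X₂ → ℝ)} {K : g.Site → g.Site → ℝ}
    (h : ∀ (x : X₂) (y' : g.Site),
      ∑ x₁ ∈ Finset.univ.filter (fun x₁ => blk₁ x₁ = y'), |T (Pi.single x₁ 1) x| ≤ K (blk₂ x) y') :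
    HasMajorantHom blk₁ blk₂ T K := by
  intro y' μ B hμ x
  exact (abs_apply_le_blockRowSum_mul blk₁ T hμ.off hμ.bound x).trans
    (mul_le_mul_of_nonneg_right (h x y') hμ.nonneg)

/-- **THE DICTIONARY, pv08 side**: the two-lattice block majorant of [3] (2.51) IS the block row-mass bound — the
ℓ^∞ → ℓ^∞ operator norm of each block is ≤ K. [cite: Balaban1984PropagatorsII, (2.51) p.232] -/
theorem hasMajorantHom_iff_blockRowSum_le (blk₁ : X₁ → g.Site) (blk₂ : X₂ → g.Site)
    (T : (X₁ → ℝ) →ₗ[ℝ] (X₂ → ℝ)) (K : g.Site → g.Site → ℝ) :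
    HasMajorantHom blk₁ blk₂ T K ↔
      ∀ (x : X₂) (y' : g.Site),
        ∑ x₁ ∈ Finset.univ.filter (fun x₁ => blk₁ x₁ = y'), |T (Pi.single x₁ 1) x| ≤ K (blk₂ x) y' :=
  ⟨blockRowSum_le_of_hasMajorantHom blk₁ blk₂, hasMajorantHom_of_blockRowSum_le blk₁ blk₂⟩

/-- **Block row-mass bound ⟹ `HasMaj` between the sharp block sup-sizes** (`BlockNorm.ofBlocks`, κ = 1) of [15]
Sect. G's vocabulary, for two lattices and `K ≥ 0` — the two-lattice generalisation of `B11SectG.hasMaj_of_hasMajorant`.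
[cite: Balaban1985Variational, (189)–(190) p.308; Balaban1984PropagatorsII, (2.51) p.232] -/
theorem hasMaj_ofBlocks_of_blockRowSum_le [Fintype X₂] (blk₁ : X₁ → g.Site) (blk₂ : X₂ → g.Site)
    {T : (X₁ → ℝ) →ₗ[ℝ] (X₂ → ℝ)} {K : g.Site → g.Site → ℝ} (hK : ∀ a b, 0 ≤ K a b)
    (h : ∀ (x : X₂) (y' : g.Site),
      ∑ x₁ ∈ Finset.univ.filter (fun x₁ => blk₁ x₁ = y'), |T (Pi.single x₁ 1) x| ≤ K (blk₂ x) y') :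
    HasMaj (BlockNorm.ofBlocks g blk₁) (BlockNorm.ofBlocks g blk₂) T K := by
  intro y' μ hμ y
  have hB : 0 ≤ (BlockNorm.ofBlocks g blk₁).loc y' μ := (BlockNorm.ofBlocks g blk₁).loc_nonneg y' μ
  refine loc_ofBlocks_le blk₂ (T μ) (mul_nonneg (hK _ _) hB) fun x hx => ?_
  rw [← hx]
  exact (abs_apply_le_blockRowSum_mul blk₁ T hμ (fun x₁ hx₁ => abs_le_loc_ofBlocks blk₁ μ hx₁) x).trans
    (mul_le_mul_of_nonneg_right (h x y') hB)

/-- **`HasMaj` between the sharp block sup-sizes ⟹ block row-mass bound** (`K ≥ 0`): test on the sign pattern of the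
row, a source localised in the block of `y′` of size ≤ 1. [cite: Balaban1985Variational, (190) p.308; Balaban1984PropagatorsII, (2.51) p.232] -/
theorem blockRowSum_le_of_hasMaj_ofBlocks [Fintype X₂] (blk₁ : X₁ → g.Site) (blk₂ : X₂ → g.Site)
    {T : (X₁ → ℝ) →ₗ[ℝ] (X₂ → ℝ)} {K : g.Site → g.Site → ℝ} (hK : ∀ a b, 0 ≤ K a b)
    (h : HasMaj (BlockNorm.ofBlocks g blk₁) (BlockNorm.ofBlocks g blk₂) T K) :
    ∀ (x : X₂) (y' : g.Site),
      ∑ x₁ ∈ Finset.univ.filter (fun x₁ => blk₁ x₁ = y'), |T (Pi.single x₁ 1) x| ≤ K (blk₂ x) y' := by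
  intro x y'
  set μ : X₁ → ℝ := fun x₁ => if blk₁ x₁ = y' then (if 0 ≤ T (Pi.single x₁ 1) x then 1 else -1) else 0 with hμ
  have hs := blockSupp_signSource blk₁ T y' x
  have hloc : (BlockNorm.ofBlocks g blk₁).IsLoc y' μ := fun x₁ hx₁ => hs.off x₁ hx₁
  have hle1 : (BlockNorm.ofBlocks g blk₁).loc y' μ ≤ 1 := loc_ofBlocks_le blk₁ μ zero_le_one hs.bound
  have h1 := h y' μ hloc (blk₂ x)
  have h2 : |T μ x| ≤ K (blk₂ x) y' * 1 :=
    ((abs_le_loc_ofBlocks blk₂ (T μ) rfl).trans h1).trans (mul_le_mul_of_nonneg_left hle1 (hK _ _))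
  rw [mul_one, hμ, apply_signSource_eq_blockRowSum blk₁ T y' x] at h2
  exact le_trans (le_abs_self _) h2

/-- **THE DICTIONARY, Sect. G side** (`K ≥ 0`): `HasMaj (ofBlocks blk₁) (ofBlocks blk₂) T K` ⟺ every block of `T`
has ℓ^∞ → ℓ^∞ norm ≤ K. [cite: Balaban1985Variational, (189)–(190) p.308; Balaban1984PropagatorsII, (2.51) p.232] -/
theorem hasMaj_ofBlocks_iff_blockRowSum_le [Fintype X₂] (blk₁ : X₁ → g.Site) (blk₂ : X₂ → g.Site)
    (T : (X₁ → ℝ) →ₗ[ℝ] (X₂ → ℝ)) {K : g.Site → g.Site → ℝ} (hK : ∀ a b, 0 ≤ K a b) :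
    HasMaj (BlockNorm.ofBlocks g blk₁) (BlockNorm.ofBlocks g blk₂) T K ↔
      ∀ (x : X₂) (y' : g.Site),
        ∑ x₁ ∈ Finset.univ.filter (fun x₁ => blk₁ x₁ = y'), |T (Pi.single x₁ 1) x| ≤ K (blk₂ x) y' :=
  ⟨blockRowSum_le_of_hasMaj_ofBlocks blk₁ blk₂ hK, hasMaj_ofBlocks_of_blockRowSum_le blk₁ blk₂ hK⟩

/-- `HasMajorantHom` with `K ≥ 0` ⟹ `HasMaj` between the sharp block sizes. [cite: Balaban1984PropagatorsII, (2.51) p.232] -/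
theorem hasMaj_ofBlocks_of_hasMajorantHom [Fintype X₂] (blk₁ : X₁ → g.Site) (blk₂ : X₂ → g.Site)
    {T : (X₁ → ℝ) →ₗ[ℝ] (X₂ → ℝ)} {K : g.Site → g.Site → ℝ} (hK : ∀ a b, 0 ≤ K a b)
    (h : HasMajorantHom blk₁ blk₂ T K) :
    HasMaj (BlockNorm.ofBlocks g blk₁) (BlockNorm.ofBlocks g blk₂) T K :=
  hasMaj_ofBlocks_of_blockRowSum_le blk₁ blk₂ hK (blockRowSum_le_of_hasMajorantHom blk₁ blk₂ h)

/-- `HasMaj` between the sharp block sizes with `K ≥ 0` ⟹ `HasMajorantHom`. [cite: Balaban1984PropagatorsII, (2.51) p.232] -/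
theorem hasMajorantHom_of_hasMaj_ofBlocks [Fintype X₂] (blk₁ : X₁ → g.Site) (blk₂ : X₂ → g.Site)
    {T : (X₁ → ℝ) →ₗ[ℝ] (X₂ → ℝ)} {K : g.Site → g.Site → ℝ} (hK : ∀ a b, 0 ≤ K a b)
    (h : HasMaj (BlockNorm.ofBlocks g blk₁) (BlockNorm.ofBlocks g blk₂) T K) :
    HasMajorantHom blk₁ blk₂ T K :=
  hasMajorantHom_of_blockRowSum_le blk₁ blk₂ (blockRowSum_le_of_hasMaj_ofBlocks blk₁ blk₂ hK h)

/-! ### Matrix forms (the read-off for matrix-valued NODE-O objects) -/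
/-- `(toLin' A)(δ_{x₁})(x) = A x x₁`. [folklore] -/
private theorem toLin'_single_apply (A : Matrix X₂ X₁ ℝ) (x : X₂) (x₁ : X₁) :
    Matrix.toLin' A (Pi.single x₁ 1) x = A x x₁ := by
  simp [Matrix.toLin'_apply, Matrix.mulVec, dotProduct, Pi.single_apply]

/-- **Matrix form**: block row masses `Σ_{x₁ ∈ blk₁⁻¹ y′} |A x x₁| ≤ K(blk₂ x, y′)` with `K ≥ 0` give
`HasMaj (ofBlocks blk₁) (ofBlocks blk₂) (toLin' A) K` — the letter shape of NODE D from a real matrix whose blocks have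
ℓ^∞ → ℓ^∞ norms ≤ K (the cell's `Gaps.D4WalkBlock.blockNorm`∕`rowMass` currency, ‖·‖ of a real entry = |·|).
[cite: Balaban1985Variational, (189)–(190) p.308; Balaban1985BackgroundPropagators, (3.108) p.416] -/
theorem hasMaj_ofBlocks_toLin'_of_blockRowSum_le [Fintype X₂] (blk₁ : X₁ → g.Site) (blk₂ : X₂ → g.Site)
    (A : Matrix X₂ X₁ ℝ) {K : g.Site → g.Site → ℝ} (hK : ∀ a b, 0 ≤ K a b)
    (h : ∀ (x : X₂) (y' : g.Site), ∑ x₁ ∈ Finset.univ.filter (fun x₁ => blk₁ x₁ = y'), |A x x₁| ≤ K (blk₂ x) y') :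
    HasMaj (BlockNorm.ofBlocks g blk₁) (BlockNorm.ofBlocks g blk₂) (Matrix.toLin' A) K :=
  hasMaj_ofBlocks_of_blockRowSum_le blk₁ blk₂ hK fun x y' => by
    simpa only [toLin'_single_apply] using h x y'

/-- **Matrix form, converse**: `HasMaj (ofBlocks blk₁) (ofBlocks blk₂) (toLin' A) K` with `K ≥ 0` bounds the block
row masses of `A`. [cite: Balaban1985Variational, (190) p.308] -/
theorem blockRowSum_le_of_hasMaj_ofBlocks_toLin' [Fintype X₂] (blk₁ : X₁ → g.Site) (blk₂ : X₂ → g.Site)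
    (A : Matrix X₂ X₁ ℝ) {K : g.Site → g.Site → ℝ} (hK : ∀ a b, 0 ≤ K a b)
    (h : HasMaj (BlockNorm.ofBlocks g blk₁) (BlockNorm.ofBlocks g blk₂) (Matrix.toLin' A) K) :
    ∀ (x : X₂) (y' : g.Site), ∑ x₁ ∈ Finset.univ.filter (fun x₁ => blk₁ x₁ = y'), |A x x₁| ≤ K (blk₂ x) y' :=
  fun x y' => by
    simpa only [toLin'_single_apply] using blockRowSum_le_of_hasMaj_ofBlocks blk₁ blk₂ hK h x y'

end Dictionary

/-! ## 2. (190) on the torus of blocks, block letters in, block bound out -/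
section Block190

variable {ν : ℕ} {Nf : ℕ → Fin ν → ℕ} [∀ n i, NeZero (Nf n i)]
variable {XB XA X3 : ℕ → Type} [∀ n, Fintype (XB n)] [∀ n, Fintype (XA n)] [∀ n, Fintype (X3 n)]
  [∀ n, DecidableEq (XB n)] [∀ n, DecidableEq (XA n)] [∀ n, DecidableEq (X3 n)]

/-- **(190) IN PRINT'S BLOCK CURRENCY ON THE TORUS OF BLOCKS.**  Per step n: the torus of blocks `UT (Nf n)` (d₁ =
`tdist1`), the B-, A- and |·|₍₋₃₎-lattices `XB n`, `XA n`, `X3 n` fibred over it by block maps `blkB n`, `blkA n`, `blk3 n`,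
the Sect. G operators as real linear maps — G̃ (`Gt : X3 → XA`), W = ((δ²∕δA′²)V)(𝒜₀ + H₀B) (`W : XA → X3`), Δ⁽²⁾H₀
(`D2H0 : XB → X3`), H₀, H, 𝔄₀, δ𝓗 (`H0`, `Hk`, `A0`, `dH : XB → XA`), 𝔇 (`Dfr : XA → XB`) — with letters (torus-free
constants, rate δ₀ > 0) each an ℓ^∞ → ℓ^∞ BLOCK bound `Σ_{x′ ∈ blk⁻¹ y′} |T(δ_{x′})(x)| ≤ a·e^{−r·d₁(blk x, y′)}`: G̃ at
(B_G, δ₀), (189) W at (θ_W, ¼δ₀) (author-omitted, cell GAPS G-B11-G2), Δ⁽²⁾H₀ (c_Δ, δ₀), H₀ (A₀, δ₀), H (A_H, ½δ₀),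
𝔇 (θ_𝔇, ½δ₀), (188) 𝔄₀ ≤ M₀(n); carriers (184), (182); the Neumann ratio of (187) `qG 1 1 B_G θ_W c < 1` with the (2.61)
constant `c ≥ c₀(σ∕δ₀)^ν` on the block torus (`0 < σ ≤ ⅛δ₀`); `Cst` above the written-out O(1); any `δ15 ≤ δ₀`.
CONCLUSION — (190) verbatim in shape (*"for x ∈ Δ(y), supp ⊂ Δ̃(y′)"*): for every n, A-site x and block y′,
`Σ_{x′ ∈ blkB⁻¹ y′} |δ𝓗_n(δ_{x′})(x)| ≤ Cst·e^{−⅛δ15·d₁(blkA x, y′)}`.  Proof: `h190_of_sectG_torusGeom` (generation 91) in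
the sharp block sizes `BlockNorm.ofBlocks (toB6 (torusGeom (Nf n) 0 0 0) 0 True) (blk· n)` (κ = 1), letters in and
conclusion out through §1.  Nothing of Bałaban's is constructed; the block maps and operators are parameters.
[cite: Balaban1985Variational, (182)-(190) pp.307-308; Balaban1984PropagatorsII, (2.51) p.232, Lemma 2.1 (2.61) p.234; Balaban1985BackgroundPropagators, (3.108) p.416] -/
theorem block190_of_sectG_torusGeom
    (blkB : (n : ℕ) → XB n → UT (Nf n)) (blkA : (n : ℕ) → XA n → UT (Nf n)) (blk3 : (n : ℕ) → X3 n → UT (Nf n))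
    (Gt : (n : ℕ) → (X3 n → ℝ) →ₗ[ℝ] (XA n → ℝ)) (W : (n : ℕ) → (XA n → ℝ) →ₗ[ℝ] (X3 n → ℝ))
    (D2H0 : (n : ℕ) → (XB n → ℝ) →ₗ[ℝ] (X3 n → ℝ))
    (H0 Hk A0 dH : (n : ℕ) → (XB n → ℝ) →ₗ[ℝ] (XA n → ℝ)) (Dfr : (n : ℕ) → (XA n → ℝ) →ₗ[ℝ] (XB n → ℝ))
    (M₀ : ℕ → ℝ) {δ₀ σ c BG θW cΔ A₀ AH₂ θD Cst δ15 : ℝ}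
    (hδ₀ : 0 < δ₀) (hσ₀ : 0 < σ) (hσ : σ ≤ δ₀ / 8) (hc : B6.c0 δ₀ (σ / δ₀) ^ ν ≤ c)
    (hBG : 0 ≤ BG) (hθW : 0 ≤ θW) (hcΔ : 0 ≤ cΔ) (hA₀ : 0 ≤ A₀) (hAH₂ : 0 ≤ AH₂) (hθD : 0 ≤ θD) (hM₀ : ∀ n, 0 ≤ M₀ n)
    (hG : ∀ n (x : XA n) (y' : UT (Nf n)),
      ∑ x' ∈ Finset.univ.filter (fun x' => blk3 n x' = y'), |Gt n (Pi.single x' 1) x| ≤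
        BG * Real.exp (-(δ₀ * tdist1 (Nf n) (blkA n x) y')))
    (h189 : ∀ n (x : X3 n) (y' : UT (Nf n)),
      ∑ x' ∈ Finset.univ.filter (fun x' => blkA n x' = y'), |W n (Pi.single x' 1) x| ≤
        θW * Real.exp (-(δ₀ / 4 * tdist1 (Nf n) (blk3 n x) y')))
    (hD2H0 : ∀ n (x : X3 n) (y' : UT (Nf n)),
      ∑ x' ∈ Finset.univ.filter (fun x' => blkB n x' = y'), |D2H0 n (Pi.single x' 1) x| ≤
        cΔ * Real.exp (-(δ₀ * tdist1 (Nf n) (blk3 n x) y')))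
    (hH0 : ∀ n (x : XA n) (y' : UT (Nf n)),
      ∑ x' ∈ Finset.univ.filter (fun x' => blkB n x' = y'), |H0 n (Pi.single x' 1) x| ≤
        A₀ * Real.exp (-(δ₀ * tdist1 (Nf n) (blkA n x) y')))
    (hH : ∀ n (x : XA n) (y' : UT (Nf n)),
      ∑ x' ∈ Finset.univ.filter (fun x' => blkB n x' = y'), |Hk n (Pi.single x' 1) x| ≤
        AH₂ * Real.exp (-(δ₀ / 2 * tdist1 (Nf n) (blkA n x) y')))
    (hDfr : ∀ n (x : XB n) (y' : UT (Nf n)),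
      ∑ x' ∈ Finset.univ.filter (fun x' => blkA n x' = y'), |Dfr n (Pi.single x' 1) x| ≤
        θD * Real.exp (-(δ₀ / 2 * tdist1 (Nf n) (blkB n x) y')))
    (h188 : ∀ n (x : XA n) (y' : UT (Nf n)),
      ∑ x' ∈ Finset.univ.filter (fun x' => blkB n x' = y'), |A0 n (Pi.single x' 1) x| ≤ M₀ n)
    (h184 : ∀ n, Eq184 (A0 n) (H0 n) (Gt n) (W n) (D2H0 n))
    (h182 : ∀ n, Eq182 (dH n) (A0 n) (H0 n) (Hk n) (Dfr n))
    (hq : qG 1 1 BG θW c < 1)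
    (hCst : (1 * BG * (cΔ + 1 * θW * (A₀ + constA0 1 1 BG θW cΔ A₀ c) * c) * c + A₀) +
        1 * AH₂ * (1 * θD * (constA0 1 1 BG θW cΔ A₀ c + A₀) * c) * c ≤ Cst)
    (hδ15 : δ15 ≤ δ₀) :
    ∀ n (x : XA n) (y' : UT (Nf n)),
      ∑ x' ∈ Finset.univ.filter (fun x' => blkB n x' = y'), |dH n (Pi.single x' 1) x| ≤
        Cst * Real.exp (-(δ15 / 8 * tdist1 (Nf n) (blkA n x) y')) := by
  intro n
  have hexp : ∀ (a r : ℝ), 0 ≤ a → ∀ m (y y' : UT (Nf m)), 0 ≤ a * Real.exp (-(r * tdist1 (Nf m) y y')) :=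
    fun a r ha m y y' => mul_nonneg ha (Real.exp_nonneg _)
  have hc0 : 0 ≤ c := (pow_nonneg (B6RandomWalk.c0_nonneg δ₀ (σ / δ₀)) ν).trans hc
  have hcA0 : 0 ≤ constA0 1 1 BG θW cΔ A₀ c := constA0_nonneg zero_le_one zero_le_one hBG hθW hcΔ hA₀ hc0 hq
  have hCst0 : 0 ≤ Cst := le_trans (by positivity) hCst
  -- the sharp block sizes on the torus of blocks; the geometry letters η, L, M, R, H of `torusGeom`∕`toB6` are
  -- carried, never read: take them trivial
  letI hdec : ∀ m, DecidableEq (toB6 (torusGeom (Nf m) 0 0 0) 0 True).Site :=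
    fun m => (inferInstance : DecidableEq (UT (Nf m)))
  -- §1 read in: a block row-mass letter at (a, r) is a `HasMaj` letter between the sharp block sizes
  have hin : ∀ (m : ℕ) {Y₁ Y₂ : Type} [Fintype Y₁] [DecidableEq Y₁] [Fintype Y₂] (b₁ : Y₁ → UT (Nf m))
      (b₂ : Y₂ → UT (Nf m)) (T : (Y₁ → ℝ) →ₗ[ℝ] (Y₂ → ℝ)) {a r : ℝ}, 0 ≤ a →
      (∀ (x : Y₂) (y' : UT (Nf m)), ∑ x' ∈ Finset.univ.filter (fun x' => b₁ x' = y'), |T (Pi.single x' 1) x| ≤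
        a * Real.exp (-(r * tdist1 (Nf m) (b₂ x) y'))) →
      HasMaj (BlockNorm.ofBlocks (toB6 (torusGeom (Nf m) 0 0 0) 0 True) b₁)
        (BlockNorm.ofBlocks (toB6 (torusGeom (Nf m) 0 0 0) 0 True) b₂) T
        (fun y y' => a * Real.exp (-(r * tdist1 (Nf m) y y'))) :=
    fun m _ _ _ _ _ b₁ b₂ T a r ha h => hasMaj_ofBlocks_of_blockRowSum_le
      (g := toB6 (torusGeom (Nf m) 0 0 0) 0 True) b₁ b₂ (fun y y' => mul_nonneg ha (Real.exp_nonneg _)) h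
  have h188' : ∀ m, Bound188 (BlockNorm.ofBlocks (toB6 (torusGeom (Nf m) 0 0 0) 0 True) (blkB m))
      (BlockNorm.ofBlocks (toB6 (torusGeom (Nf m) 0 0 0) 0 True) (blkA m)) (A0 m) (M₀ m) :=
    fun m => hasMaj_ofBlocks_of_blockRowSum_le (g := toB6 (torusGeom (Nf m) 0 0 0) 0 True) (blkB m) (blkA m)
      (fun _ _ => hM₀ m) (h188 m)
  have h189' : ∀ m, Ineq189 (BlockNorm.ofBlocks (toB6 (torusGeom (Nf m) 0 0 0) 0 True) (blkA m))
      (BlockNorm.ofBlocks (toB6 (torusGeom (Nf m) 0 0 0) 0 True) (blk3 m)) (W m) θW δ₀ :=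
    fun m => hin m (blkA m) (blk3 m) (W m) hθW (h189 m)
  have h190 := h190_of_sectG_torusGeom (I := Unit) (Nf := Nf) (η := fun _ => 0) (L := fun _ => 0) (M := fun _ => 0)
    (R := fun _ => 0) (H := fun _ => True)
    (fun m => BlockNorm.ofBlocks (toB6 (torusGeom (Nf m) 0 0 0) 0 True) (blkB m))
    (fun m => BlockNorm.ofBlocks (toB6 (torusGeom (Nf m) 0 0 0) 0 True) (blkA m))
    (fun m => BlockNorm.ofBlocks (toB6 (torusGeom (Nf m) 0 0 0) 0 True) (blk3 m))
    (fun m _ => BlockNorm.ofBlocks (toB6 (torusGeom (Nf m) 0 0 0) 0 True) (blkA m))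
    Gt W D2H0 H0 Hk A0 dH Dfr M₀ (κB := 1) (κN := 1) (κ₃ := 1) (BG₂ := BG) (A₀₂ := A₀)
    hδ₀ hσ₀ hσ hc hBG hBG hθW hcΔ hA₀ hA₀ hAH₂ hθD hM₀ (fun _ => le_rfl) (fun _ => le_rfl) (fun _ => le_rfl)
    (fun m => hin m (blk3 m) (blkA m) (Gt m) hBG (hG m))
    (fun m _ => hin m (blk3 m) (blkA m) (Gt m) hBG (hG m))
    h189'
    (fun m => hin m (blkB m) (blk3 m) (D2H0 m) hcΔ (hD2H0 m))
    (fun m => hin m (blkB m) (blkA m) (H0 m) hA₀ (hH0 m))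
    (fun m _ => hin m (blkB m) (blkA m) (H0 m) hA₀ (hH0 m))
    (fun m _ => hin m (blkB m) (blkA m) (Hk m) hAH₂ (hH m))
    (fun m => hin m (blkA m) (blkB m) (Dfr m) hθD (hDfr m))
    h184 h188' h182 hq hCst hδ15
  -- §1 read out
  exact blockRowSum_le_of_hasMaj_ofBlocks (g := toB6 (torusGeom (Nf n) 0 0 0) 0 True) (blkB n) (blkA n)
    (hexp Cst (δ15 / 8) hCst0 n) (h190 n ())

/-- **(190) IN THE BLOCK CURRENCY, MATRIX LETTERS** — `block190_of_sectG_torusGeom` for the seven operators given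
as REAL MATRICES (rows = output sites, columns = input sites; the shape of matrix-valued NODE-O objects such as the
cell's walk expansions at real parameters): block row masses `Σ_{x′ ∈ blk⁻¹ y′} |A x x′| ≤ a·e^{−r·d₁(blk x, y′)}` in,
the carriers (184) `𝔄₀ + (G̃W)𝔄₀ = G̃Δ⁽²⁾H₀ − (G̃W)H₀` and (182) `δ𝓗 = (𝔄₀ + H₀) − H·𝔇·(𝔄₀ + H₀)` as MATRIX identities,
and (190) out: `Σ_{x′ ∈ blkB⁻¹ y′} |δ𝓗_n x x′| ≤ Cst·e^{−⅛δ15·d₁(blkA x, y′)}` (via `Matrix.toLin'`,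
`Matrix.toLin'_mul`).  Nothing of Bałaban's is constructed; the matrices are parameters.
[cite: Balaban1985Variational, (182)-(190) pp.307-308; Balaban1985BackgroundPropagators, (3.108) p.416; Balaban1984PropagatorsII, (2.51) p.232] -/
theorem block190_of_sectG_torusGeom_toLin'
    (blkB : (n : ℕ) → XB n → UT (Nf n)) (blkA : (n : ℕ) → XA n → UT (Nf n)) (blk3 : (n : ℕ) → X3 n → UT (Nf n))
    (Gt : (n : ℕ) → Matrix (XA n) (X3 n) ℝ) (W : (n : ℕ) → Matrix (X3 n) (XA n) ℝ)
    (D2H0 : (n : ℕ) → Matrix (X3 n) (XB n) ℝ)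
    (H0 Hk A0 dH : (n : ℕ) → Matrix (XA n) (XB n) ℝ) (Dfr : (n : ℕ) → Matrix (XB n) (XA n) ℝ)
    (M₀ : ℕ → ℝ) {δ₀ σ c BG θW cΔ A₀ AH₂ θD Cst δ15 : ℝ}
    (hδ₀ : 0 < δ₀) (hσ₀ : 0 < σ) (hσ : σ ≤ δ₀ / 8) (hc : B6.c0 δ₀ (σ / δ₀) ^ ν ≤ c)
    (hBG : 0 ≤ BG) (hθW : 0 ≤ θW) (hcΔ : 0 ≤ cΔ) (hA₀ : 0 ≤ A₀) (hAH₂ : 0 ≤ AH₂) (hθD : 0 ≤ θD) (hM₀ : ∀ n, 0 ≤ M₀ n)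
    (hG : ∀ n (x : XA n) (y' : UT (Nf n)),
      ∑ x' ∈ Finset.univ.filter (fun x' => blk3 n x' = y'), |Gt n x x'| ≤
        BG * Real.exp (-(δ₀ * tdist1 (Nf n) (blkA n x) y')))
    (h189 : ∀ n (x : X3 n) (y' : UT (Nf n)),
      ∑ x' ∈ Finset.univ.filter (fun x' => blkA n x' = y'), |W n x x'| ≤
        θW * Real.exp (-(δ₀ / 4 * tdist1 (Nf n) (blk3 n x) y')))
    (hD2H0 : ∀ n (x : X3 n) (y' : UT (Nf n)),
      ∑ x' ∈ Finset.univ.filter (fun x' => blkB n x' = y'), |D2H0 n x x'| ≤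
        cΔ * Real.exp (-(δ₀ * tdist1 (Nf n) (blk3 n x) y')))
    (hH0 : ∀ n (x : XA n) (y' : UT (Nf n)),
      ∑ x' ∈ Finset.univ.filter (fun x' => blkB n x' = y'), |H0 n x x'| ≤
        A₀ * Real.exp (-(δ₀ * tdist1 (Nf n) (blkA n x) y')))
    (hH : ∀ n (x : XA n) (y' : UT (Nf n)),
      ∑ x' ∈ Finset.univ.filter (fun x' => blkB n x' = y'), |Hk n x x'| ≤
        AH₂ * Real.exp (-(δ₀ / 2 * tdist1 (Nf n) (blkA n x) y')))
    (hDfr : ∀ n (x : XB n) (y' : UT (Nf n)),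
      ∑ x' ∈ Finset.univ.filter (fun x' => blkA n x' = y'), |Dfr n x x'| ≤
        θD * Real.exp (-(δ₀ / 2 * tdist1 (Nf n) (blkB n x) y')))
    (h188 : ∀ n (x : XA n) (y' : UT (Nf n)),
      ∑ x' ∈ Finset.univ.filter (fun x' => blkB n x' = y'), |A0 n x x'| ≤ M₀ n)
    (h184 : ∀ n, A0 n + (Gt n * W n) * A0 n = Gt n * D2H0 n - (Gt n * W n) * H0 n)
    (h182 : ∀ n, dH n = (A0 n + H0 n) - Hk n * (Dfr n * (A0 n + H0 n)))
    (hq : qG 1 1 BG θW c < 1)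
    (hCst : (1 * BG * (cΔ + 1 * θW * (A₀ + constA0 1 1 BG θW cΔ A₀ c) * c) * c + A₀) +
        1 * AH₂ * (1 * θD * (constA0 1 1 BG θW cΔ A₀ c + A₀) * c) * c ≤ Cst)
    (hδ15 : δ15 ≤ δ₀) :
    ∀ n (x : XA n) (y' : UT (Nf n)),
      ∑ x' ∈ Finset.univ.filter (fun x' => blkB n x' = y'), |dH n x x'| ≤
        Cst * Real.exp (-(δ15 / 8 * tdist1 (Nf n) (blkA n x) y')) := by
  have h184' : ∀ n, Eq184 (Matrix.toLin' (A0 n)) (Matrix.toLin' (H0 n)) (Matrix.toLin' (Gt n))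
      (Matrix.toLin' (W n)) (Matrix.toLin' (D2H0 n)) := fun n => by
    have h := congrArg Matrix.toLin' (h184 n)
    simp only [map_add, map_sub, Matrix.toLin'_mul] at h
    exact h
  have h182' : ∀ n, Eq182 (Matrix.toLin' (dH n)) (Matrix.toLin' (A0 n)) (Matrix.toLin' (H0 n))
      (Matrix.toLin' (Hk n)) (Matrix.toLin' (Dfr n)) := fun n => by
    have h := congrArg Matrix.toLin' (h182 n)
    simp only [map_add, map_sub, Matrix.toLin'_mul] at h
    exact h
  have h190 := block190_of_sectG_torusGeom blkB blkA blk3 (fun n => Matrix.toLin' (Gt n))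
    (fun n => Matrix.toLin' (W n)) (fun n => Matrix.toLin' (D2H0 n)) (fun n => Matrix.toLin' (H0 n))
    (fun n => Matrix.toLin' (Hk n)) (fun n => Matrix.toLin' (A0 n)) (fun n => Matrix.toLin' (dH n))
    (fun n => Matrix.toLin' (Dfr n)) M₀ hδ₀ hσ₀ hσ hc hBG hθW hcΔ hA₀ hAH₂ hθD hM₀
    (fun n x y' => by simpa only [toLin'_single_apply] using hG n x y')
    (fun n x y' => by simpa only [toLin'_single_apply] using h189 n x y')
    (fun n x y' => by simpa only [toLin'_single_apply] using hD2H0 n x y')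
    (fun n x y' => by simpa only [toLin'_single_apply] using hH0 n x y')
    (fun n x y' => by simpa only [toLin'_single_apply] using hH n x y')
    (fun n x y' => by simpa only [toLin'_single_apply] using hDfr n x y')
    (fun n x y' => by simpa only [toLin'_single_apply] using h188 n x y') h184' h182' hq hCst hδ15
  exact fun n x y' => by simpa only [toLin'_single_apply] using h190 n x y'

end Block190

end Literature.MathematicalPhysics.QuantumFieldTheory.Balaban1983to89.Beta.RemainderDecay190SectGBlocks
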